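import Summits.BirchSwinnertonDyer.BirchSwinnertonDyer.Theses.ByReductionTypeAtTwo
import Literature.NumberTheory.EllipticCurves.TwoAdicImageNonSurjectiveFamiliesProofs
import Literature.NumberTheory.EllipticCurves.QuadraticTwist
import Literature.NumberTheory.EllipticCurves.Rank1Residual.Predicates
import HarnessLib

/-!
# Sketch (gen 4, ideator 2/2) — crux-ideate on `RankOneAtTwoOffBigImageOddLocal` (item stmt-BirchSwinnertonDyer-23716)

Typed first-lemma signatures and small PROVED placement lemmas for the crux idea card
`resolvent-door-cm-congruence-at-two` (strata γ₂a: `-Δ ∈ ℚ^{×2}`, γ₂d: `-2Δ ∈ ℚ^{×2}` of the complement of the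
served slice; there the quadratic resolvent `K₀ = ℚ(√Δ)` of the 2-division field is `ℚ(i)` resp. `ℚ(√-2)` and, when
`E(ℚ)[2] = 0`, `E[2] ⊗ 𝔽₄ ≅ Ind_{K₀}^ℚ ψ` is residually CM-dihedral from `K₀`).  The card takes `K₀` ITSELF as the
Heegner / anticyclotomic field ("the door is the resolvent").  Nothing here proves BSD, BSD₂ or the crux.

PROVED (logic / tree theorem `not_forall_hasSurjectiveModNGaloisRep_two_pow_iff` only): γ₂a and γ₂d lie off the
2-adic big-image locus (`gamma2a_not_bigImage`, `gamma2d_not_bigImage`), the restriction `onResolventDoorOpen_of_crux`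
(the crux implies its γ₂a/γ₂d door-open face) and the assembly `onResolventDoorOpen_of` (floor criterion + its two
inputs ⇒ the face).  STATED as `Prop`s (nothing asserted): `ParityLawInertAtResolvent` (first checkable lemma L0),
`ResolventDoorFloorAtTwo U` (the floor criterion, over an abstract GL₁ unit predicate `U` = definition request D1),
`OnResolventDoorOpen` (the transfer target C⁺ = the crux restricted to the resolvent face with the door open).
-/

noncomputable section

open scoped Classical

namespace Summit.BirchSwinnertonDyer.BirchSwinnertonDyer.Cruxes.RankOneAtTwoOffBigImageOddLocal.ResolventDoor

open WeierstrassCurve Literature.NumberTheory.EllipticCurves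
  Literature.NumberTheory.EllipticCurves.Rank1Residual

/-! ## §1 Placement of γ₂a / γ₂d (proved) -/

section placement
variable {W : WeierstrassCurve ℚ} [W.IsElliptic]

/-- γ₂a (`-Δ` a rational square, resolvent field `ℚ(i)`) lies OFF the 2-adic big-image locus. -/
theorem gamma2a_not_bigImage (h : IsSquare (-W.Δ)) : ¬ ∀ m : ℕ, W.HasSurjectiveModNGaloisRep ((2 ^ m : ℕ) : ℤ) :=
  (not_forall_hasSurjectiveModNGaloisRep_two_pow_iff W).mpr (Or.inr (Or.inr (Or.inl h)))

/-- γ₂d (`-2Δ` a rational square, resolvent field `ℚ(√-2)`) lies OFF the 2-adic big-image locus. -/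
theorem gamma2d_not_bigImage (h : IsSquare (-2 * W.Δ)) : ¬ ∀ m : ℕ, W.HasSurjectiveModNGaloisRep ((2 ^ m : ℕ) : ℤ) :=
  (not_forall_hasSurjectiveModNGaloisRep_two_pow_iff W).mpr (Or.inr (Or.inr (Or.inr (Or.inr (Or.inr h)))))

/-- The resolvent face: `d₀ ∈ {-1, -2}` with `d₀ Δ ∈ ℚ^{×2}`, i.e. `K₀ = ℚ(√Δ) = ℚ(√d₀)`. -/
def OnResolventFace (W : WeierstrassCurve ℚ) (d₀ : ℚ) : Prop := (d₀ = -1 ∨ d₀ = -2) ∧ IsSquare (d₀ * W.Δ)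

theorem not_bigImage_of_onResolventFace {d₀ : ℚ} (h : OnResolventFace W d₀) :
    ¬ ∀ m : ℕ, W.HasSurjectiveModNGaloisRep ((2 ^ m : ℕ) : ℤ) := by
  obtain ⟨hd, hsq⟩ := h
  rcases hd with rfl | rfl
  · exact gamma2a_not_bigImage (by simpa using hsq)
  · exact gamma2d_not_bigImage (by simpa using hsq)

end placement

/-! ## §2 Typed statements of the card (Props; nothing asserted) -/

/-- **L0, first checkable lemma (parity law at primes inert in the resolvent field).** On γ₂a, for every odd prime
`ℓ ≡ 3 (mod 4)` of good reduction, `a_ℓ(E)` is even: `Δ = -m²` is a non-square mod `ℓ`, so the 2-division cubic has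
exactly one root in `𝔽_ℓ`, `Ẽ(𝔽_ℓ)[2] ≅ ℤ/2` and `#Ẽ(𝔽_ℓ)` is even (equivalently: `Frob_ℓ` is a transposition in
`S₃ = GL₂(𝔽₂)`, of trace `0`).  This is the numerical shadow of `ρ̄_{E,2} ≅ Ind_{ℚ(i)}^ℚ ψ`.  Elementary; M-sized. -/
def ParityLawInertAtResolvent : Prop :=
  ∀ (W : WeierstrassCurve ℚ) [W.IsElliptic] [W.IsGloballyMinimal], IsSquare (-W.Δ) →
    ∀ (ℓ : ℕ) [Fact ℓ.Prime], ℓ % 4 = 3 → W.HasGoodReductionAtPrime ℓ → Even (W.frobeniusTrace ℓ)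

/-- **C⁺, the transfer target (= the crux restricted to the resolvent face with the resolvent door open).**
Non-CM, `d₀ ∈ {-1,-2}` with `d₀Δ ∈ ℚ^{×2}`, `E(ℚ)[2] = 0`, analytic rank `1`, and the rank-0 twin at the resolvent
door `E^{(d₀)}` has analytic rank `0` (equivalently `ord_{s=1} L(E/K₀, s) = 1`) ⇒ `BSD₂(E/ℚ)`.  OPEN; nothing asserted. -/
def OnResolventDoorOpen : Prop :=
  ∀ (W : WeierstrassCurve ℚ) [W.IsElliptic] [W.IsGloballyMinimal] (d₀ : ℚ), ¬ W.HasCM → OnResolventFace W d₀ →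
    (∀ P : W.toAffine.Point, 2 • P = 0 → P = 0) → W.analyticRank = 1 →
      (W.quadraticTwist d₀).analyticRank = 0 → BSDp W 2

/-- The crux implies its resolvent-door-open face (the face is off the big-image locus, so the slice conjunction
`big image ∧ odd torsion ∧ odd Tamagawa` fails there). -/
theorem onResolventDoorOpen_of_crux (h : Theses.ByReductionTypeAtTwo.RankOneAtTwoOffBigImageOddLocal) :
    OnResolventDoorOpen := by
  intro W _ _ d₀ hCM hface _h2 hr _htwin
  exact h W hCM (fun hs => not_bigImage_of_onResolventFace hface hs.1) hr

/-- **K1, the floor criterion (typed over an abstract GL₁ unit predicate `U`; OPEN; nothing asserted).**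
`U W d₀` is DEFINITION REQUEST D1 of the card: "the 2-adic GL₁ datum of `K₀ = ℚ(√d₀)` attached to `E` is a unit" —
concretely the `ψ_E`-part of the 2-class group of `K₀(E[2])` vanishes and the normalised 2-adic Hecke `L`-value
`L_2(φ₀ ψ̃_E)` (Katz–Kriz measure of `K₀` at the ramified prime 2) is a 2-adic unit.  The criterion: on the
resolvent face with the door open, odd Tamagawa product and `U`, BSD₂ holds (mechanism: mod-λ congruence of
normalised 2-adic Heegner logarithms over `K₀` between `E` and the weight-2 CM form `θ(φ₀ψ̃_E)` ⇒ the Heegner point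
`y_{K₀}` has odd index; class-group control of `Sel₂(E/K₀)` ⇒ `Ш(E/K₀)[2] = 0`; Gross–Zagier + rank-0 twin ⇒ BSD₂). -/
def ResolventDoorFloorAtTwo (U : WeierstrassCurve ℚ → ℚ → Prop) : Prop :=
  ∀ (W : WeierstrassCurve ℚ) [W.IsElliptic] [W.IsGloballyMinimal] (d₀ : ℚ), ¬ W.HasCM → OnResolventFace W d₀ →
    (∀ P : W.toAffine.Point, 2 • P = 0 → P = 0) → Odd W.tamagawaProduct → U W d₀ → W.analyticRank = 1 →
      (W.quadraticTwist d₀).analyticRank = 0 → BSDp W 2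

/-- **K2, the tower (typed as the complement of the floor; OPEN; nothing asserted).** Off the unit locus (or with even
Tamagawa product) the resolvent face with open door still satisfies BSD₂ (mechanism: imprimitive anticyclotomic main
conjecture for `E/K₀` at 2 by `(μ, λ)`-transport to the GL₁ main conjectures of `K₀` at 2 for the `ψ_E`-twisted
branches, 2-adic Waldspurger/BDP formula over `K₀`, descent). -/
def ResolventDoorTowerAtTwo (U : WeierstrassCurve ℚ → ℚ → Prop) : Prop :=
  ∀ (W : WeierstrassCurve ℚ) [W.IsElliptic] [W.IsGloballyMinimal] (d₀ : ℚ), ¬ W.HasCM → OnResolventFace W d₀ →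
    (∀ P : W.toAffine.Point, 2 • P = 0 → P = 0) → ¬ (Odd W.tamagawaProduct ∧ U W d₀) → W.analyticRank = 1 →
      (W.quadraticTwist d₀).analyticRank = 0 → BSDp W 2

/-- Assembly on the face: floor + tower ⇒ C⁺ (pure logic; certifies that K1 and K2 are typed against C⁺). -/
theorem onResolventDoorOpen_of (U : WeierstrassCurve ℚ → ℚ → Prop)
    (hfloor : ResolventDoorFloorAtTwo U) (htower : ResolventDoorTowerAtTwo U) : OnResolventDoorOpen := by
  intro W _ _ d₀ hCM hface h2 hr htwin
  by_cases hU : Odd W.tamagawaProduct ∧ U W d₀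
  · exact hfloor W d₀ hCM hface h2 hU.1 hU.2 hr htwin
  · exact htower W d₀ hCM hface h2 hU hr htwin

end Summit.BirchSwinnertonDyer.BirchSwinnertonDyer.Cruxes.RankOneAtTwoOffBigImageOddLocal.ResolventDoor

end
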